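import Summits.BirchSwinnertonDyer.BirchSwinnertonDyer.Theorems.ErratumRoadFiveEulerHalfGenusLineGlue
import HarnessLib

/-!
# The genus line on `EulerHalfPOnlyMultPotMultTwinAtFive` — proved cone III: label (b) ⟸ its road-K twins; (b2b) ⟸ (b2b-κ);
# THE SPLIT GLUE OF 23444 AS A THEOREM (RULING 112 package A2c ∕ A3)

Sequel of `ErratumRoadFiveEulerHalfGenusLineGlue.lean` (seat `bsd-idea-9` g26; theorems VERBATIM from genus v1.9, 0b77ab8cd161 ∕
db8dd4f847057d98, against the tree-level vocabulary `Theorems.GenusLine.*`): `zhang_isKolyvaginPrime_of_kolyvaginPrime`,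
`genusKolyvaginPointDivAtP_of_twins` (label (b) ⟸ (b1) `GenusMcCallum52` + (b2a) `GenusJetchev53` + (b2b) `GenusJetchevThm63` +
modularity), `EulerHalfPOnlyMultPotMultTwinAtFive_of_printedFacts_of_twins`, `genusJetchevThm63_of_classDataSupply` ((b2b) ⟸ (b2b-κ)
`GenusClassDataSupply` + road K's two local schemas, by road K's `JET.jetchevDivisibilityCarrierMult_of_localFacts₂`),
`EulerHalfPOnlyMultPotMultTwinAtFive_of_printedFacts_of_classData` (the crux BY NAME from the eight items + the printed facts + the
two schemas + (b1) + (b2a) + (b2b-κ)), and NEW (A3) **`eulerHalfPOnlyMultPotMultTwinAtFive_of_genusChildren :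
GenusMcCallum52 → GenusJetchev53 → GenusClassDataSupply → GenusLinePrintedInputs → EulerHalfPOnlyMultPotMultTwinAtFive`** — the
4-ary GLUE of the pen's intended `route edit --split EulerHalfPOnlyMultPotMultTwinAtFive --into GenusMcCallum52 GenusJetchev53
GenusClassDataSupply GenusLinePrintedInputs` (RULING 112), kernel-checked: it closes that split's glue item the moment it is typed.
HONEST FRAMING: conditional theorems only — every binder displayed; no stub of any line is closed; the crux 19715, its target 23444 and every genus child stay OPEN; no summit statement is proved; BSD is proved for no curve.
References: [Jetchev2008] §3.1, Props. 4.7, 4.9, 5.3, Lemma 5.2, Thms. 5.2, 6.3, (11); [McCallumLMS1991] Prop. 5.2; [Zhang2014] §3;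
[Howard2004HeegnerKolyvagin] Prop. 2.1.9; [GrossLMS1991] Prop. 3.7.
-/

set_option autoImplicit false
-- D-0017: single-problem summit, so `Summit.BirchSwinnertonDyer.BirchSwinnertonDyer.…` repeats a namespace BY DESIGN.
set_option linter.dupNamespace false

noncomputable section

namespace Summit.BirchSwinnertonDyer.BirchSwinnertonDyer.Theorems.GenusLine

open scoped Classical

open NumberField IsDedekindDomain Field Rat.HeightOneSpectrum
open WeierstrassCurve Literature.NumberTheory.EllipticCurves
  Literature.NumberTheory.EllipticCurves.ModularForms
  Literature.NumberTheory.EllipticCurves.CaiShuTian2014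
  Literature.NumberTheory.EllipticCurves.Rank1Residual
  Literature.NumberTheory.EllipticCurves.Rank1Residual.Typed
  Literature.NumberTheory.GaloisRepresentations
open Summit.BirchSwinnertonDyer.Rank1Residual
open Summit.BirchSwinnertonDyer.BirchSwinnertonDyer.Theorems
  Summit.BirchSwinnertonDyer.BirchSwinnertonDyer.Theorems.GenusGrossZagier
  Summit.BirchSwinnertonDyer.BirchSwinnertonDyer.Theorems.RamifiedTwinGenusHeegner
  Summit.BirchSwinnertonDyer.BirchSwinnertonDyer.Theorems.RamifiedTwinRamTransport

/-! ### §1h Label (b) from its road-K twins (b1) ∕ (b2a) ∕ (b2b) — PROVED -/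

/-- **A Gross Kolyvagin prime of level `M ≥ 1` for `(W, K, p)` is a Zhang–Kolyvagin prime of `W` with `M ≤ M(ℓ)`** (`W` modular of
level `N_W` by `DtW`; Gross (3.3): `p^M ∣ a_ℓ`, `p^M ∣ ℓ + 1`, via the tree's `pow_dvd_frobeniusTrace_of_kolyvaginPrime` and
`pow_dvd_add_one_of_frobEqFrobInfty`, read through `Zhang2014.le_kolyvaginIndex_iff`).  The `W`-side companion of
`GenusKolyvagin.zhang_isKolyvaginPrime_of_twist_presentation` (p694410).  [cite: GrossLMS1991, §3 (3.1)–(3.3)]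
[cite: WZhang2014, Notations (xii)] -/
theorem zhang_isKolyvaginPrime_of_kolyvaginPrime (W : WeierstrassCurve ℚ) [W.IsElliptic] [W.IsGloballyMinimal]
    [NeZero (W.conductorNorm ℤ)] (DtW : ModularParametrizationData W (W.conductorNorm ℤ))
    {K : Type} [Field K] [NumberField K] {p : ℕ} [Fact p.Prime] {ℓ : ℕ}
    (hℓ : IsKolyvaginPrime (W.conductorNorm ℤ) W K p ℓ) {M : ℕ} (hM : 1 ≤ M) (hℓM : FrobEqFrobInfty W K (p ^ M) ℓ) :
    Zhang2014.IsKolyvaginPrime (W.conductorNorm ℤ) W K p ℓ ∧ M ≤ Zhang2014.kolyvaginIndex W p ℓ := by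
  have hp : p.Prime := Fact.out
  have haW : ((p ^ M : ℕ) : ℤ) ∣ W.frobeniusTrace ℓ := pow_dvd_frobeniusTrace_of_kolyvaginPrime DtW hp hM hℓ hℓM
  have hidx : M ≤ Zhang2014.kolyvaginIndex W p ℓ := by
    rw [Zhang2014.le_kolyvaginIndex_iff]
    refine ⟨pow_dvd_add_one_of_frobEqFrobInfty W (K := K) hp hM hℓ.1 hℓ.2.2.2.1 hℓM, ?_⟩
    exact_mod_cast haW
  exact ⟨⟨hℓ.1, hℓ.2.1, hℓ.2.2.1, hℓ.2.2.2.1, hℓ.2.2.2.2.1, lt_of_lt_of_le hM hidx⟩, hidx⟩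

/-- **CHILD (b) FROM ITS ROAD-K TWINS — PROVED (v1.8).**  `GenusKolyvaginPointDivAtP` (Jetchev's divisibility read point-wise for
the genus family) follows from (b1) `GenusMcCallum52`, (b2a) `GenusJetchev53`, (b2b) `GenusJetchevThm63` and modularity of `W`
(`nonempty_modularParametrizationData`, used ONLY to read Gross's level-`M` Kolyvagin primes as Zhang–Kolyvagin primes of index
`≥ M`, `zhang_isKolyvaginPrime_of_kolyvaginPrime`): ONE application of the frame-free road-K bridge
`GenusKolyvagin.FrameFree.pointFamily_divisible_of_prop52_of_prop53_of_thm63` (p704151) to the CM-presentation family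
`(GenusKolyvaginDatum, genusFamilyPoint)` with Zhang's `IsKolyvaginPrime ∕ kolyvaginIndex ∕ levelIndex` for `(W, K, p)`,
`Core k c := Jetchev2008.IsGlobalCoreVertex W K S.ιc τ p k c` for the complex conjugation `τ`
(`JET.exists_algEquiv_ne_one_of_isImaginaryQuadratic`), `t := ord_p ∏_ℓ c_ℓ(W)`, `s := min(M, t)`; `W(K[c])[p] = 0` from x11b3
(`X11b.RingClassNoTorsion.eq_zero_of_zsmul_pow_eq_zero_ringClassField`, `ρ̄_{W,p}` onto from the `FrameProfile`, `p ≥ 5`); ring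
class fields of `K` are number fields at ALL conductors (road K's `JET.numberField_ringClassField`,
`Theorems/Rank1ResidualJetRingClassFields.lean`).  Exactly road K's
`JET.jetchevDivisibilityCarrierMult_of_prop52_of_coreVertexExistence` shape: K3 ⟸ {h52, K5, H63}.  Conditional on the displayed
binders; no summit statement is proved.  [cite: Jetchev2008, Proof of Thm. 1.1 (p. 824), Prop. 5.3, Thm. 5.2]
[cite: McCallumLMS1991, §5 Prop. 5.2 (p. 304)] [cite: GrossLMS1991, §3 (3.3), §4 Lemma 4.3] -/
theorem genusKolyvaginPointDivAtP_of_twins (hmodP : nonempty_modularParametrizationData)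
    (h52 : GenusMcCallum52) (h53 : GenusJetchev53) (h63 : GenusJetchevThm63) : GenusKolyvaginPointDivAtP := by
  intro W _ _ A _ _ p q _ _ K _ _ S hprof hidx hsha hPinf
  haveI := S.ell
  haveI := S.min
  haveI := S.nz
  haveI := S.nf
  intro M hM m hm hKol Q hQ ϑ' hϑ'2 hϑ'0 g T hg hT hT'
  have hp : p.Prime := Fact.out
  have hp2 : p ≠ 2 := by have := hprof.five_le; omega
  haveI : NeZero (W.conductorNorm ℤ) := ⟨(WeierstrassCurve.conductorNorm_pos_holds _).ne'⟩
  obtain ⟨DtW⟩ := hmodP W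
  have hKolZ : ∀ ℓ ∈ m.primeFactors, Zhang2014.IsKolyvaginPrime (W.conductorNorm ℤ) W K p ℓ ∧
      M ≤ Zhang2014.kolyvaginIndex W p ℓ :=
    fun ℓ h ↦ zhang_isKolyvaginPrime_of_kolyvaginPrime W DtW (hKol ℓ h).1 hM (hKol ℓ h).2
  haveI : ∀ k : ℕ, NumberField (ringClassField K S.ιc k) := fun k ↦ JET.numberField_ringClassField K hprof.quad S.ιc k
  obtain ⟨τ, hτ⟩ := JET.exists_algEquiv_ne_one_of_isImaginaryQuadratic K hprof.quad
  let δ : GenusKolyvaginDatum S.E' K S.ιc S.Dt S.β S.d₁ m := ⟨Q, hQ, ϑ', hϑ'2, hϑ'0, g, T, hg, hT, hT'⟩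
  exact GenusKolyvagin.FrameFree.pointFamily_divisible_of_prop52_of_prop53_of_thm63 hp
    (Zhang2014.IsKolyvaginPrime (W.conductorNorm ℤ) W K p) (Zhang2014.kolyvaginIndex W p) (Zhang2014.levelIndex W p)
    (fun c s ↦ Zhang2014.natCast_le_levelIndex_iff) (D := fun c ↦ GenusKolyvaginDatum S.E' K S.ιc S.Dt S.β S.d₁ c)
    (fun c δ ↦ genusFamilyPoint W S.E' S.D S.C₂ S.hWd K S.ιc δ)
    (fun c hc _ R hR ↦ X11b.RingClassNoTorsion.eq_zero_of_zsmul_pow_eq_zero_ringClassField W hprof.quad S.ιc hc.ne_zero hp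
      hp2 hprof.surj 1 R (by simpa using hR))
    (fun k c ↦ Jetchev2008.IsGlobalCoreVertex W K S.ιc τ p k c) (padicValNat p W.tamagawaProduct)
    (h52 W A p q K S hprof hidx hsha hPinf) (h53 W A p q K S hprof hidx hsha hPinf τ hτ)
    (h63 W A p q K S hprof hidx hsha hPinf τ hτ) (min M (padicValNat p W.tamagawaProduct)) (min_le_right _ _) m δ hm
    (fun ℓ h ↦ ⟨(hKolZ ℓ h).1, (min_le_left _ _).trans (hKolZ ℓ h).2⟩)

/-- §2 (v1.8) THE POST-ASIDE SHAPE WITH THE THREE ROAD-K TWINS — PROVED, NO `sorry`-DEPENDENCE: the eight ER5 items + the three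
printed Heegner-point facts + (b1) `GenusMcCallum52` + (b2a) `GenusJetchev53` + (b2b) `GenusJetchevThm63` BY NAME → the crux BY NAME
(`EulerHalfPOnlyMultPotMultTwinAtFive_of_printedFacts_of_labelB ∘ genusKolyvaginPointDivAtP_of_twins`).  Road K's K-line shape for
the genus system: {McCallum 5.2, Jetchev 5.3, [J] Thm 6.3-instantiated} with kernel glue.  Conditional on the displayed binders;
the three twins are the research content of child (b); BSD is proved for no curve.
[cite: Jetchev2008, Thm. 1.4, Prop. 5.3, Thm. 5.2, Proof of Thm. 1.1] [cite: McCallumLMS1991, §5 Prop. 5.2] [cite: GrossLMS1991, §§3–6] -/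
theorem EulerHalfPOnlyMultPotMultTwinAtFive_of_printedFacts_of_twins
    (hSk : Summit.BirchSwinnertonDyer.BirchSwinnertonDyer.Theses.ErratumRoadFive.SkinnerRankZeroPPart)
    (hGZK : Summit.BirchSwinnertonDyer.BirchSwinnertonDyer.Theses.ErratumRoadFive.RankEqAnalyticRankLeOne)
    (hmod : Summit.BirchSwinnertonDyer.BirchSwinnertonDyer.Theses.ErratumRoadFive.EntireLFunctionRat)
    (hnf : Summit.BirchSwinnertonDyer.BirchSwinnertonDyer.Theses.ErratumRoadFive.NewformOfEllipticCurve)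
    (hMaz : Summit.BirchSwinnertonDyer.BirchSwinnertonDyer.Theses.ErratumRoadFive.MazurManinConstantOddPrimes)
    (hGZ73 : Summit.BirchSwinnertonDyer.BirchSwinnertonDyer.Theses.ErratumRoadFive.GrossZagierRationalPointI73)
    (hHL : Summit.BirchSwinnertonDyer.BirchSwinnertonDyer.Theses.ErratumRoadFive.HoffsteinLuoNonvanishingTwist)
    (hCST : Summit.BirchSwinnertonDyer.BirchSwinnertonDyer.Theses.ErratumRoadFive.CaiShuTianGrossZagierRingClassChar)
    (hG1 : ∀ (N : ℕ) [NeZero N] (W : WeierstrassCurve ℚ) (K : Type) [Field K] [NumberField K],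
      phi_heegnerPointOfConductor_mem_range_map_ringClassField_birch N W K)
    (hNek : Nekovar2007.cmPoint_frobeniusCongruence)
    (hP53 : ∀ (N : ℕ) [NeZero N] (W : WeierstrassCurve ℚ) (K : Type) [Field K] [NumberField K],
      GrossLMS1991.prop53_conj_pinned_birch N W K)
    (h52 : GenusMcCallum52) (h53 : GenusJetchev53) (h63 : GenusJetchevThm63) :
    Summit.BirchSwinnertonDyer.BirchSwinnertonDyer.Theses.ErratumRoadFive.EulerHalfPOnlyMultPotMultTwinAtFive :=
  EulerHalfPOnlyMultPotMultTwinAtFive_of_printedFacts_of_labelB hSk hGZK hmod hnf hMaz hGZ73 hHL hCST hG1 hNek hP53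
    (genusKolyvaginPointDivAtP_of_twins (nonempty_modularParametrizationData_of_exists_isNewformOf hnf IsNewformOf.exists_maninConstant_ne_zero_holds)
      h52 h53 h63)

/-! ### §1i (b2b) `GenusJetchevThm63` ⟸ (b2b-κ) `GenusClassDataSupply` + road K's two local schemas — PROVED -/

section ClassDataGlue

open Literature.NumberTheory.EllipticCurves.Jetchev2008 Literature.NumberTheory.GaloisCohomology
  Literature.NumberTheory.GaloisRepresentations.DiscreteGaloisModule
  Summit.BirchSwinnertonDyer.Rank1Residual.JET.SelmerVocabulary Literature.NumberTheory.Automorphic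

/-- **(b2b) ⟸ (b2b-κ) + road K's two local print-to-type schemas — PROVED (v1.9).**  `GenusJetchevThm63` from
`GenusClassDataSupply` and road K's OWN schemas `hloc` ([J] Lemma 5.2 (i)–(ii): the `±`-parts of the Kummer condition at an
inert Kolyvagin place have index `p^k`) and `h𝒯sd` (Howard Prop. 2.1.9 (ii): the intrinsic transverse condition at the primes of
`c` is its own annihilator), VERBATIM the binders of `JET.jetchevDivisibilityCarrierMult_of_localFacts₂`, by ONE application of
the landed class-data theorem `GenusKolyvagin.ClassData.tamagawaExponent_le_mInfty_of_classData_localFacts` (p708110) at the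
split carrier place `v₀ ∣ p` of the served frame.  Kernel glue: `v₀` with `τ • v₀ ≠ v₀`, `N, p ∈ v₀`
(`ShimuraWalk.exists_split_place_of_ncard_eq_two` on `FrameProfile.sp`∕`splitp`); `c_{v₀}(W⁄K) = c_p(W)`, minimality
(`JET.carrierRowData_of_split`); `t = ord_p c_p(W)` (`FrameProfile.only`: the place of `p` is the unique split multiplicative
place, `CornerLocal.padicValNat_tamagawaNumberAt_eq_of_unique_split`, `localTamagawaNumber_padic_eq_holds`); `Φ_{v₀}` cyclic
(`JET.kodairaNeron_isAddCyclic_forall`, `p ∣ c_p` in the non-trivial case `t ≥ 1`); `τ² = 1`; `¬CM`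
(`not_hasSurjectiveModNGaloisRep_of_hasCM`) and the surjective `p^n`-tower
(`forall_hasSurjectiveModNGaloisRep_pow_of_multiplicative_of_surj`) from `surj`; Poitou–Tate for Selmer structures
(`InputsPoitouTateSelmer.poitouTate_selmerStructure_duality_conj_holds`, landed).  Conditional on the displayed binders; no
summit statement is proved.  [cite: Jetchev2008, Thm. 5.2 (p. 821) and proof (pp. 821–823), Lemma 5.2, Prop. 4.7, Prop. 4.9]
[cite: Howard2004HeegnerKolyvagin, Prop. 2.1.9, Thm. 2.1.11] [cite: Zywina2015, Prop. 1.14] [cite: CasselsFrohlichANT1967, Ch. VII Prop. 1.2 (ii)]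
[cite: SilvermanATAEC1994, Cor. IV.9.2 (d)] -/
theorem genusJetchevThm63_of_classDataSupply
    (hloc : ∀ (W : WeierstrassCurve ℚ) [W.IsElliptic] [W.IsGloballyMinimal]
      (K : Type) [Field K] [NumberField K], IsImaginaryQuadratic K →
      ∀ (τ : K ≃ₐ[ℚ] K), τ ≠ 1 → ∀ (p k : ℕ) [Fact p.Prime], p ≠ 2 → 1 ≤ k →
      ∀ (ℓ : ℕ), Zhang2014.IsKolyvaginPrime (W.conductorNorm ℤ) W K p ℓ →
        k ≤ Zhang2014.kolyvaginIndex W p ℓ →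
      ∀ (v : HeightOneSpectrum (𝓞 K)), (ℓ : 𝓞 K) ∈ v.asIdeal → ∀ (hfix : τ • v = v)
        (s : ℤ), s = 1 ∨ s = -1 →
      ((W.baseChange K).kummerSelmerStructure ((p ^ k : ℕ) : ℤ) (Sum.inr v)).relIndex
        ((conjActPlace W τ ((p ^ k : ℕ) : ℤ) hfix - s • AddMonoidHom.id _).ker) = p ^ k)
    (h𝒯sd : ∀ (W : WeierstrassCurve ℚ) [W.IsElliptic] [W.IsGloballyMinimal]
      (K : Type) [Field K] [NumberField K], IsImaginaryQuadratic K →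
      ∀ (ι : K →+* ℂ) [∀ j : ℕ, NumberField (ringClassField K ι j)]
      (p k : ℕ) [Fact p.Prime] [NeZero (p ^ k)] [Finite (geomTorsion (W.baseChange K) ((p ^ k : ℕ) : ℤ))],
      p ≠ 2 → ∀ (c : ℕ), Squarefree c → (∀ ℓ ∈ c.primeFactors,
        Zhang2014.IsKolyvaginPrime (W.conductorNorm ℤ) W K p ℓ ∧ k ≤ Zhang2014.kolyvaginIndex W p ℓ) →
      ∀ (𝒯 : SelmerStructure ((W.baseChange K).torsionGaloisModule ((p ^ k : ℕ) : ℤ))),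
      (∀ v : HeightOneSpectrum (𝓞 K), 𝒯 (Sum.inr v) =
        ⨅ ℓ ∈ c.primeFactors.filter (fun ℓ : ℕ ↦ ((ℓ : ℕ) : 𝓞 K) ∈ v.asIdeal),
          ⨅ (w' : HeightOneSpectrum (𝓞 (ringClassField K ι ℓ))) (_ : w'.asIdeal.LiesOver v.asIdeal),
            letI := (adicCompletionOfLiesOver K (ringClassField K ι ℓ) v w').toAlgebra
            transverseSubgroup (GaloisRep.toLocal v ((W.baseChange K).torsionGaloisModule ((p ^ k : ℕ) : ℤ)))
              (w'.adicCompletion (ringClassField K ι ℓ))) →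
      ∀ (e : geomTorsion (W.baseChange K) ((p ^ k : ℕ) : ℤ) →
          geomTorsion (W.baseChange K) ((p ^ k : ℕ) : ℤ) → AlgebraicClosure K)
        (hμ : ∀ S T, e S T ^ (p ^ k) = 1)
        (hadd₁ : ∀ S₁ S₂ T, e (S₁ + S₂) T = e S₁ T * e S₂ T)
        (hadd₂ : ∀ S T₁ T₂, e S (T₁ + T₂) = e S T₁ * e S T₂)
        (hgal : ∀ (g : absoluteGaloisGroup K) (S T : geomTorsion (W.baseChange K) ((p ^ k : ℕ) : ℤ)),
          g • e S T = e (g • S) (g • T)),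
      (∀ T, e T T = 1) → (∀ T, (∀ S, e S T = 1) → T = 0) →
      ∀ inv : LocalInvariants K (p ^ k), inv.IsPerfect → ∀ v ∈ placesDividing K c,
      inv.dualTransported 𝒯 (weilDualIntertwining (W.baseChange K) (p ^ k) e hμ hadd₁ hadd₂ hgal)
        (Sum.inr v) = 𝒯 (Sum.inr v))
    (hκ : GenusClassDataSupply) : GenusJetchevThm63 := by
  intro W _ _ A _ _ p q _ _ K _ _ S hprof hidx hsha hPinf
  haveI := S.ell
  haveI := S.min
  haveI := S.nz
  haveI := S.nf
  intro _ τ hτ mdiv m hmdiv hm mInf hmInf hMin k c hk hcore hmc hkM htk hik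
  have hp : p.Prime := Fact.out
  have hp5 : 5 ≤ p := hprof.five_le
  have hp2 : p ≠ 2 := by omega
  have hK : IsImaginaryQuadratic K := hprof.quad
  haveI : NeZero (W.conductorNorm ℤ) := ⟨(WeierstrassCurve.conductorNorm_pos_holds _).ne'⟩
  -- trivial case `t = 0`
  by_cases ht0 : padicValNat p W.tamagawaProduct = 0
  · rw [ht0]; exact Nat.zero_le _
  -- the place of `ℚ` at `p` is the UNIQUE split multiplicative place (`only`, `splitp`): `t = ord_p c_p(W)`
  have hbridge : ∀ (v : HeightOneSpectrum (𝓞 ℚ)) (r : ℕ) [Fact r.Prime], (primesEquiv v : ℕ) = r →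
      W.HasSplitMultiplicativeReductionAtPrime r → W.HasSplitMultiplicativeReductionAt v := by
    intro v r _ hv h
    subst hv
    exact (WeierstrassCurve.hasSplitMultiplicativeReductionAtPrime_iff_hasSplitMultiplicativeReductionAt W v).mp h
  set vℚ : HeightOneSpectrum (𝓞 ℚ) := (primesEquiv (R := 𝓞 ℚ)).symm ⟨p, hp⟩ with hvℚ_def
  have hvℚ : (primesEquiv vℚ : ℕ) = p := by rw [hvℚ_def, Equiv.apply_symm_apply]
  have hsℚ : W.HasSplitMultiplicativeReductionAt vℚ := hbridge vℚ p hvℚ hprof.splitp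
  have huniq : ∀ v, W.HasSplitMultiplicativeReductionAt v → v = vℚ := by
    intro v hv
    haveI : Fact (primesEquiv v : ℕ).Prime := ⟨(primesEquiv v).2⟩
    have hmv : W.HasMultiplicativeReductionAtPrime (primesEquiv v : ℕ) :=
      (WeierstrassCurve.hasMultiplicativeReductionAtPrime_primesEquiv_iff_holds W v (primesEquiv v : ℕ) rfl).mpr
        hv.hasMultiplicativeReductionAt
    have hvp : (primesEquiv v : ℕ) = p := hprof.only _ hmv
    apply (primesEquiv (R := 𝓞 ℚ)).injective
    rw [hvℚ_def, Equiv.apply_symm_apply]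
    exact Subtype.ext hvp
  have ht : padicValNat p W.tamagawaProduct = padicValNat p ((W.baseChange ℚ_[p]).localTamagawaNumber ℤ_[p]) := by
    rw [← CornerLocal.padicValNat_tamagawaNumberAt_eq_of_unique_split W p hp5 hsℚ huniq,
      WeierstrassCurve.tamagawaNumberAt_def, WeierstrassCurve.localTamagawaNumber_padic_eq_holds W vℚ p hvℚ]
  -- the split carrier place `v₀ ∣ p` of `K` (`sp` at `p ∣ N`, `p ≠ q`) and the transport of the row data
  have hmult : W.HasMultiplicativeReductionAtPrime p := hprof.splitp.hasMultiplicativeReductionAtPrime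
  have hpN : p ∣ W.conductorNorm ℤ :=
    (W.dvd_conductorNorm_iff_not_hasGoodReductionAtPrime p).mpr
      (WeierstrassCurve.HasMultiplicativeReduction.not_hasGoodReduction (R := ℤ_[p]) hmult)
  obtain ⟨v₀, hv₀, hv₀N, hpv₀⟩ := ShimuraWalk.exists_split_place_of_ncard_eq_two K hK τ hτ p
    (hprof.sp p hp hpN (fun h ↦ hprof.q_ne h.symm)) hpN
  obtain ⟨hminK, hminP, hcEq, hc0, hcyc⟩ := JET.carrierRowData_of_split W K p hK τ v₀ hv₀ hpv₀
  haveI := hminK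
  haveI := hminP
  have hdvd : p ∣ (W.baseChange ℚ_[p]).localTamagawaNumber ℤ_[p] := by
    have h1 : 1 ≤ padicValNat p ((W.baseChange ℚ_[p]).localTamagawaNumber ℤ_[p]) := by
      rw [← ht]; exact Nat.one_le_iff_ne_zero.mpr ht0
    exact dvd_of_one_le_padicValNat h1
  haveI := hcyc (JET.kodairaNeron_isAddCyclic_forall W p p hp2 hdvd)
  -- `τ² = 1`
  haveI : Algebra.IsQuadraticExtension ℚ K := ⟨hK.1⟩
  have hτ2 : τ * τ = 1 := by
    have hcard : Nat.card (K ≃ₐ[ℚ] K) = 2 := by rw [IsGalois.card_aut_eq_finrank, hK.1]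
    obtain ⟨y, -, hyu⟩ := (Nat.card_eq_two_iff' (1 : K ≃ₐ[ℚ] K)).mp hcard
    have h1 : τ = y := hyu τ hτ
    have h2 : τ⁻¹ = y := hyu τ⁻¹ (inv_ne_one.mpr hτ)
    rw [mul_eq_one_iff_eq_inv]
    exact h1.trans h2.symm
  -- level `p^k`
  haveI : NeZero (p ^ k) := ⟨pow_ne_zero k hp.ne_zero⟩
  haveI : Finite (geomTorsion (W.baseChange K) ((p ^ k : ℕ) : ℤ)) :=
    finite_geomTorsion_of_neZero (W.baseChange K) (p ^ k)
  have hn : ((p ^ k : ℕ) : ℤ) ≠ 0 := by exact_mod_cast pow_ne_zero k hp.ne_zero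
  -- the frame inputs of the class-data theorem: `¬CM`, the surjective tower, Poitou–Tate
  have hcm : ¬ W.HasCM := fun h ↦ W.not_hasSurjectiveModNGaloisRep_of_hasCM h hp hp2 hprof.surj
  have htower : ∀ n : ℕ, W.HasSurjectiveModNGaloisRep (p ^ n : ℕ) :=
    W.forall_hasSurjectiveModNGaloisRep_pow_of_multiplicative_of_surj p hp2 hmult hprof.surj
  have hPT : poitouTate_selmerStructure_duality_conj K :=
    InputsPoitouTateSelmer.poitouTate_selmerStructure_duality_conj_holds K
  -- Kolyvagin data of the core vertex
  have hkc : (k : ℕ∞) ≤ Zhang2014.levelIndex W p c.1 := le_trans le_self_add hkM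
  have hcK : ∀ ℓ ∈ c.1.primeFactors, Zhang2014.IsKolyvaginPrime (W.conductorNorm ℤ) W K p ℓ ∧
      k ≤ Zhang2014.kolyvaginIndex W p ℓ := fun ℓ hℓ ↦
    ⟨c.2.2 ℓ hℓ, Zhang2014.natCast_le_levelIndex_iff.mp hkc ℓ hℓ⟩
  -- the exponent at `v₀` is `t`
  have hfac : (((W.baseChange K).baseChange (v₀.adicCompletion K)).localTamagawaNumber
      (v₀.adicCompletionIntegers K)).factorization p = padicValNat p W.tamagawaProduct := by
    rw [hcEq, Nat.factorization_def _ hp, ht]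
  -- `p` lies in both carrier places
  have hpτv₀ : ((p : ℕ) : 𝓞 K) ∈ (τ • v₀).asIdeal := by
    have := (HeightOneSpectrum.smul_mem_smul_asIdeal_iff τ v₀ ((p : ℕ) : 𝓞 K)).mpr hpv₀
    have hτp : τ • ((p : ℕ) : 𝓞 K) = (p : 𝓞 K) := by
      rw [← MulSemiringAction.toRingHom_apply, map_natCast]
    rwa [hτp] at this
  -- the class data of the genus family at this core vertex
  obtain ⟨ε, hε, κ, κℓ, hκsel, hκsign, hκ0, hordκ, hκℓsign, hκℓkum, h49str, h49tr, h47⟩ :=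
    hκ W A p q K S hprof hidx hsha hPinf τ hτ mdiv m hmdiv hm mInf hmInf hMin k c hk hcore hmc hkM hik hn
  rw [← hfac]
  exact GenusKolyvagin.ClassData.tamagawaExponent_le_mInfty_of_classData_localFacts W hcm K hK hPT p hp2
    htower S.ιc τ hτ hτ2 ε hε k hn c.1 c.2.1 hcK hk hcore mInf hik v₀ hv₀ hv₀N hc0 (by rw [hfac]; exact htk)
    (h𝒯sd W K hK S.ιc p k hp2 c.1 c.2.1 hcK) (fun ℓ h1 h2 _ ↦ hloc W K hK τ hτ p k hp2 hk ℓ h1 h2)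
    κ hκsel hκsign hκ0 hordκ κℓ hκℓsign hκℓkum
    (fun ℓ h1 h2 h3 q' hq' ↦ by
      rcases Finset.mem_insert.mp hq' with rfl | hq'
      · exact h49str ℓ h1 h2 h3 _ hpv₀
      · rw [Finset.mem_singleton] at hq'
        subst hq'
        exact h49str ℓ h1 h2 h3 _ hpτv₀)
    h49tr h47

/-- §2 (v1.9) THE POST-ASIDE SHAPE AFTER GEN-4 OF (b2b) — PROVED, NO `sorry`-DEPENDENCE: the eight ER5 items + the three printed
Heegner-point facts + road K's two local print-to-type schemas `hloc` ([J] Lemma 5.2 (i)–(ii)) ∕ `h𝒯sd` (Howard 2.1.9 (ii)) +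
(b1) `GenusMcCallum52` + (b2a) `GenusJetchev53` + (b2b-κ) `GenusClassDataSupply` BY NAME → the crux BY NAME
(`EulerHalfPOnlyMultPotMultTwinAtFive_of_printedFacts_of_twins ∘ genusJetchevThm63_of_classDataSupply`).  The research content of
child (b) is now {(b1), (b2a), (b2b-κ)}: McCallum 5.2 with `C = {0}`, Jetchev 5.3 core vertices, and the CLASS DATA of the genus
family; all of road K's §6 ∕ Thm. 6.3 structure is kernel-checked and shared.  Conditional on the displayed binders; BSD is proved
for no curve.  [cite: Jetchev2008, Thm. 1.4, Prop. 5.3, Thm. 5.2, Lemma 5.2, Props. 4.7, 4.9] [cite: McCallumLMS1991, §5 Prop. 5.2]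
[cite: Howard2004HeegnerKolyvagin, Prop. 2.1.9] [cite: GrossLMS1991, §§3–6] -/
theorem EulerHalfPOnlyMultPotMultTwinAtFive_of_printedFacts_of_classData
    (hSk : Summit.BirchSwinnertonDyer.BirchSwinnertonDyer.Theses.ErratumRoadFive.SkinnerRankZeroPPart)
    (hGZK : Summit.BirchSwinnertonDyer.BirchSwinnertonDyer.Theses.ErratumRoadFive.RankEqAnalyticRankLeOne)
    (hmod : Summit.BirchSwinnertonDyer.BirchSwinnertonDyer.Theses.ErratumRoadFive.EntireLFunctionRat)
    (hnf : Summit.BirchSwinnertonDyer.BirchSwinnertonDyer.Theses.ErratumRoadFive.NewformOfEllipticCurve)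
    (hMaz : Summit.BirchSwinnertonDyer.BirchSwinnertonDyer.Theses.ErratumRoadFive.MazurManinConstantOddPrimes)
    (hGZ73 : Summit.BirchSwinnertonDyer.BirchSwinnertonDyer.Theses.ErratumRoadFive.GrossZagierRationalPointI73)
    (hHL : Summit.BirchSwinnertonDyer.BirchSwinnertonDyer.Theses.ErratumRoadFive.HoffsteinLuoNonvanishingTwist)
    (hCST : Summit.BirchSwinnertonDyer.BirchSwinnertonDyer.Theses.ErratumRoadFive.CaiShuTianGrossZagierRingClassChar)
    (hG1 : ∀ (N : ℕ) [NeZero N] (W : WeierstrassCurve ℚ) (K : Type) [Field K] [NumberField K],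
      phi_heegnerPointOfConductor_mem_range_map_ringClassField_birch N W K)
    (hNek : Nekovar2007.cmPoint_frobeniusCongruence)
    (hP53 : ∀ (N : ℕ) [NeZero N] (W : WeierstrassCurve ℚ) (K : Type) [Field K] [NumberField K],
      GrossLMS1991.prop53_conj_pinned_birch N W K)
    (hloc : ∀ (W : WeierstrassCurve ℚ) [W.IsElliptic] [W.IsGloballyMinimal]
      (K : Type) [Field K] [NumberField K], IsImaginaryQuadratic K →
      ∀ (τ : K ≃ₐ[ℚ] K), τ ≠ 1 → ∀ (p k : ℕ) [Fact p.Prime], p ≠ 2 → 1 ≤ k →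
      ∀ (ℓ : ℕ), Zhang2014.IsKolyvaginPrime (W.conductorNorm ℤ) W K p ℓ →
        k ≤ Zhang2014.kolyvaginIndex W p ℓ →
      ∀ (v : HeightOneSpectrum (𝓞 K)), (ℓ : 𝓞 K) ∈ v.asIdeal → ∀ (hfix : τ • v = v)
        (s : ℤ), s = 1 ∨ s = -1 →
      ((W.baseChange K).kummerSelmerStructure ((p ^ k : ℕ) : ℤ) (Sum.inr v)).relIndex
        ((conjActPlace W τ ((p ^ k : ℕ) : ℤ) hfix - s • AddMonoidHom.id _).ker) = p ^ k)
    (h𝒯sd : ∀ (W : WeierstrassCurve ℚ) [W.IsElliptic] [W.IsGloballyMinimal]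
      (K : Type) [Field K] [NumberField K], IsImaginaryQuadratic K →
      ∀ (ι : K →+* ℂ) [∀ j : ℕ, NumberField (ringClassField K ι j)]
      (p k : ℕ) [Fact p.Prime] [NeZero (p ^ k)] [Finite (geomTorsion (W.baseChange K) ((p ^ k : ℕ) : ℤ))],
      p ≠ 2 → ∀ (c : ℕ), Squarefree c → (∀ ℓ ∈ c.primeFactors,
        Zhang2014.IsKolyvaginPrime (W.conductorNorm ℤ) W K p ℓ ∧ k ≤ Zhang2014.kolyvaginIndex W p ℓ) →
      ∀ (𝒯 : SelmerStructure ((W.baseChange K).torsionGaloisModule ((p ^ k : ℕ) : ℤ))),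
      (∀ v : HeightOneSpectrum (𝓞 K), 𝒯 (Sum.inr v) =
        ⨅ ℓ ∈ c.primeFactors.filter (fun ℓ : ℕ ↦ ((ℓ : ℕ) : 𝓞 K) ∈ v.asIdeal),
          ⨅ (w' : HeightOneSpectrum (𝓞 (ringClassField K ι ℓ))) (_ : w'.asIdeal.LiesOver v.asIdeal),
            letI := (adicCompletionOfLiesOver K (ringClassField K ι ℓ) v w').toAlgebra
            transverseSubgroup (GaloisRep.toLocal v ((W.baseChange K).torsionGaloisModule ((p ^ k : ℕ) : ℤ)))
              (w'.adicCompletion (ringClassField K ι ℓ))) →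
      ∀ (e : geomTorsion (W.baseChange K) ((p ^ k : ℕ) : ℤ) →
          geomTorsion (W.baseChange K) ((p ^ k : ℕ) : ℤ) → AlgebraicClosure K)
        (hμ : ∀ S T, e S T ^ (p ^ k) = 1)
        (hadd₁ : ∀ S₁ S₂ T, e (S₁ + S₂) T = e S₁ T * e S₂ T)
        (hadd₂ : ∀ S T₁ T₂, e S (T₁ + T₂) = e S T₁ * e S T₂)
        (hgal : ∀ (g : absoluteGaloisGroup K) (S T : geomTorsion (W.baseChange K) ((p ^ k : ℕ) : ℤ)),
          g • e S T = e (g • S) (g • T)),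
      (∀ T, e T T = 1) → (∀ T, (∀ S, e S T = 1) → T = 0) →
      ∀ inv : LocalInvariants K (p ^ k), inv.IsPerfect → ∀ v ∈ placesDividing K c,
      inv.dualTransported 𝒯 (weilDualIntertwining (W.baseChange K) (p ^ k) e hμ hadd₁ hadd₂ hgal)
        (Sum.inr v) = 𝒯 (Sum.inr v))
    (h52 : GenusMcCallum52) (h53 : GenusJetchev53) (hκ : GenusClassDataSupply) :
    Summit.BirchSwinnertonDyer.BirchSwinnertonDyer.Theses.ErratumRoadFive.EulerHalfPOnlyMultPotMultTwinAtFive :=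
  EulerHalfPOnlyMultPotMultTwinAtFive_of_printedFacts_of_twins hSk hGZK hmod hnf hMaz hGZ73 hHL hCST hG1 hNek hP53 h52 h53
    (genusJetchevThm63_of_classDataSupply hloc h𝒯sd hκ)

/-! ### §3 (A3) The split glue of 23444 as a theorem -/

/-- **(A3) THE SPLIT GLUE OF 23444 AS A THEOREM (RULING 112; seat `bsd-idea-9` g26).**  The crux BY NAME from its four
intended children BY NAME — (b1) `GenusMcCallum52`, (b2a) `GenusJetchev53`, (b2b-κ) `GenusClassDataSupply` and the bundle of
non-research inputs `GenusLinePrintedInputs` (the eight ER5 item bodies, the printed Heegner-point facts of aside 24717, road K's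
two local print-to-type schemas) — by `EulerHalfPOnlyMultPotMultTwinAtFive_of_printedFacts_of_classData` (the ER5 item decls
unfold to the bundled bodies).  Kernel-checked, no `sorry`; every child OPEN; no summit statement proved; BSD proved for no curve.
[cite: Jetchev2008, Thm. 1.4, Prop. 5.3, Thm. 5.2] [cite: McCallumLMS1991, Prop. 5.2] [cite: Skinner2016PacificMC, Thm. C] -/
theorem eulerHalfPOnlyMultPotMultTwinAtFive_of_genusChildren
    (h52 : GenusMcCallum52) (h53 : GenusJetchev53) (hκ : GenusClassDataSupply) (hI : GenusLinePrintedInputs) :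
    Summit.BirchSwinnertonDyer.BirchSwinnertonDyer.Theses.ErratumRoadFive.EulerHalfPOnlyMultPotMultTwinAtFive := by
  obtain ⟨hSk, hGZK, hmod, hnf, hMaz, hGZ73, hHL, hCST, ⟨hG1, hNek, hP53⟩, hloc, h𝒯sd⟩ := hI
  exact EulerHalfPOnlyMultPotMultTwinAtFive_of_printedFacts_of_classData hSk hGZK hmod hnf hMaz hGZ73 hHL hCST hG1 hNek
    hP53 hloc h𝒯sd h52 h53 hκ

end ClassDataGlue

end Summit.BirchSwinnertonDyer.BirchSwinnertonDyer.Theorems.GenusLine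

end
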